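import Summits.ValiantsHypothesis.ValiantsHypothesis.Theorems.BarrierLeverAnchoredDoorHitsLowerPairsBlockProduct
import Summits.ValiantsHypothesis.ValiantsHypothesis.Theorems.BarrierLeverPartitionMinorsHitByVPBrickCalculus

/-!
# Support item `AnchoredDoorHitsLowerPairs` (stmt-ValiantsHypothesis-22510), line `anchored-peeling`:
# symbolic non-vanishing of the anchored door is CLOSED UNDER WEDGES (disjoint unions glued at `∅`)

Helper file (`--supports stmt-ValiantsHypothesis-22510`; cell valiant-natproofs, rung V4, 𝒟-side door (c); prover seat
val-np-p1 gen 16). Closes NO item. Definition-free (tools from `…BlockProduct`, ns `BlockGlue`).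

`symbolicDet_wedge_ne_zero`: split the `x`-vertices by `B` and the `y`-vertices by `D`. Let `(u₁, w₁)` be a layout inside
`(B | D)` and `(u₂, w₂)` one inside `(Bᶜ | Dᶜ)`, both containing the empty row, both injective on rows, both with nonzero
symbolic minor. If the rows of an injective `u` are exactly rows of `u₁` or of `u₂` and every column of `w₁`, `w₂` occurs
among the columns of `w`, then `symbolicDet s h r u w ≠ 0`. For simplicial complexes this is the WEDGE `(K ∨ L, K' ∨ L')`
(disjoint union with the empty face identified; `r = r₁ + r₂ - 1`); with `…BlockProduct` (joins) the certified class of the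
line is closed under the two basic operations on pairs, and wedges of rigid certified pairs whose star counts do not collide
(e.g. `P_a ∨ P_b`, `…SimplexBoundary`) are new certified rigid pairs.

PROOF. Glue hit points of the factors as in `…BlockProduct` (`anchoredWitness_glue`: the member at the glued point is
`F₁ · F₂`, `F_k` the member at `p_k` with all variables off block `k` killed). Every non-constant monomial of a member
carries an `x`- and a `y`-variable (`coeff_xfree_eq_zero`, `coeff_yfree_eq_zero`), so on a block-1 column the rows of
`u₂` other than `∅` vanish and the rows of `u₁` read the layout of `F₁` (`coeff_glue_block₁`, `coeff_glue_cross₁`); a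
vector in the left kernel of the big layout therefore restricts to a left-kernel vector of each factor layout and vanishes
(`Matrix.exists_vecMul_eq_zero_iff`).

WHAT THIS IS NOT: a closure property; nothing on which pairs are hit, on item 19717, on crux stmt-ValiantsHypothesis-14610,
or on `VP` versus `VNP`.
-/

set_option linter.dupNamespace false

namespace Summit.ValiantsHypothesis.ValiantsHypothesis.Theorems.BarrierLever.AnchoredPeeling

open Finset MvPolynomial
open Summit.ValiantsHypothesis.ValiantsHypothesis.Theorems.BarrierLever.BrickCalculus (pexpo pexpo_def pexpo_apply_castAdd
  pexpo_apply_natAdd)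

noncomputable section

namespace BlockGlue

variable {h : ℕ}

/-! ## 1. Members have no `x`-free and no `y`-free non-constant monomials -/

/-- Killing all `y`-variables (resp. all `x`-variables) sends a member of 𝔄_s to `1`. -/
theorem kill_xonly_anchoredWitness (s h : ℕ) (θ : Finset (Fin h) × Finset (Fin h) → ℂ)
    (φ ψ : Finset (Fin h) × Finset (Fin h) → Fin h → ℂ) :
    kill (bvars (univ : Finset (Fin h)) ∅) (anchoredWitness s h θ φ ψ) = 1 := by
  rw [anchoredWitness_eq_prod_factor, map_prod]
  refine Finset.prod_eq_one (fun α hα => ?_)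
  rw [kill_factor, if_neg]
  rintro ⟨-, h2⟩
  have hcard : 1 ≤ α.2.card := (Finset.mem_filter.mp hα).2.2.2.1
  obtain ⟨c, hc⟩ := Finset.card_pos.mp hcard
  exact Finset.notMem_empty c (h2 hc)

/-- Symmetric version: killing all `x`-variables. -/
theorem kill_yonly_anchoredWitness (s h : ℕ) (θ : Finset (Fin h) × Finset (Fin h) → ℂ)
    (φ ψ : Finset (Fin h) × Finset (Fin h) → Fin h → ℂ) :
    kill (bvars ∅ (univ : Finset (Fin h))) (anchoredWitness s h θ φ ψ) = 1 := by
  rw [anchoredWitness_eq_prod_factor, map_prod]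
  refine Finset.prod_eq_one (fun α hα => ?_)
  rw [kill_factor, if_neg]
  rintro ⟨h1, -⟩
  have hcard : 1 ≤ α.1.card := (Finset.mem_filter.mp hα).2.1
  obtain ⟨a, ha⟩ := Finset.card_pos.mp hcard
  exact Finset.notMem_empty a (h1 ha)

/-- The exponent `x^U y^W` is supported inside the block variables of `(U | W)`. -/
theorem support_pexpo_subset_bvars (U W : Finset (Fin h)) : (pexpo U W).support ⊆ bvars U W := by
  rw [pexpo_def]; exact BlockProduct.support_partitionExpo_subset U W

/-- A nonzero exponent with empty `y`-part is not the zero exponent. -/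
theorem pexpo_empty_right_ne_zero {U : Finset (Fin h)} (hU : U.Nonempty) : pexpo U (∅ : Finset (Fin h)) ≠ 0 := by
  obtain ⟨a, ha⟩ := hU
  intro h0
  have := congrArg (fun m => m (Fin.castAdd h a)) h0
  simp only [pexpo_apply_castAdd, if_pos ha, Finsupp.coe_zero, Pi.zero_apply] at this
  exact one_ne_zero this

/-- A nonzero exponent with empty `x`-part is not the zero exponent. -/
theorem pexpo_empty_left_ne_zero {W : Finset (Fin h)} (hW : W.Nonempty) : pexpo (∅ : Finset (Fin h)) W ≠ 0 := by
  obtain ⟨c, hc⟩ := hW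
  intro h0
  have := congrArg (fun m => m (Fin.natAdd h c)) h0
  simp only [pexpo_apply_natAdd, if_pos hc, Finsupp.coe_zero, Pi.zero_apply] at this
  exact one_ne_zero this

/-- **No `y`-free monomials**: `coeff_{x^U} = 0` for nonempty `U`, in any killed member. -/
theorem coeff_yfree_eq_zero (s h : ℕ) (V : Finset (Fin (h + h))) (θ : Finset (Fin h) × Finset (Fin h) → ℂ)
    (φ ψ : Finset (Fin h) × Finset (Fin h) → Fin h → ℂ) {U : Finset (Fin h)} (hU : U.Nonempty) :
    coeff (pexpo U ∅) (kill V (anchoredWitness s h θ φ ψ)) = 0 := by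
  rw [coeff_kill]
  split_ifs
  · have key : coeff (pexpo U ∅) (anchoredWitness s h θ φ ψ) =
        coeff (pexpo U ∅) (kill (bvars (univ : Finset (Fin h)) ∅) (anchoredWitness s h θ φ ψ)) := by
      rw [coeff_kill, if_pos ((support_pexpo_subset_bvars U ∅).trans ?_)]
      rw [bvars, bvars]
      exact Finset.union_subset_union (Finset.map_subset_map.mpr (Finset.subset_univ U)) subset_rfl
    rw [key, kill_xonly_anchoredWitness, ← C_1, coeff_C, if_neg (pexpo_empty_right_ne_zero hU).symm]
  · rfl

/-- **No `x`-free monomials**: `coeff_{y^W} = 0` for nonempty `W`, in any killed member. -/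
theorem coeff_xfree_eq_zero (s h : ℕ) (V : Finset (Fin (h + h))) (θ : Finset (Fin h) × Finset (Fin h) → ℂ)
    (φ ψ : Finset (Fin h) × Finset (Fin h) → Fin h → ℂ) {W : Finset (Fin h)} (hW : W.Nonempty) :
    coeff (pexpo ∅ W) (kill V (anchoredWitness s h θ φ ψ)) = 0 := by
  rw [coeff_kill]
  split_ifs
  · have key : coeff (pexpo ∅ W) (anchoredWitness s h θ φ ψ) =
        coeff (pexpo ∅ W) (kill (bvars ∅ (univ : Finset (Fin h))) (anchoredWitness s h θ φ ψ)) := by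
      rw [coeff_kill, if_pos ((support_pexpo_subset_bvars ∅ W).trans ?_)]
      rw [bvars, bvars]
      exact Finset.union_subset_union subset_rfl (Finset.map_subset_map.mpr (Finset.subset_univ W))
    rw [key, kill_yonly_anchoredWitness, ← C_1, coeff_C, if_neg (pexpo_empty_left_ne_zero hW).symm]
  · rfl

/-- The constant coefficient of a killed member is `1`. -/
theorem coeff_zero_kill_anchoredWitness (s h : ℕ) (V : Finset (Fin (h + h))) (θ : Finset (Fin h) × Finset (Fin h) → ℂ)
    (φ ψ : Finset (Fin h) × Finset (Fin h) → Fin h → ℂ) :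
    coeff 0 (kill V (anchoredWitness s h θ φ ψ)) = 1 := by
  rw [coeff_kill, if_pos (by simp)]
  have key : coeff 0 (anchoredWitness s h θ φ ψ) =
      coeff 0 (kill (bvars (univ : Finset (Fin h)) ∅) (anchoredWitness s h θ φ ψ)) := by
    rw [coeff_kill, if_pos (by simp)]
  rw [key, kill_xonly_anchoredWitness, ← C_1, coeff_C, if_pos rfl]

/-- Splitting `x^{U₁ ∪ U₂} y^{W₁ ∪ W₂}` along the blocks. -/
theorem pexpo_union_blocks (U₁ U₂ W₁ W₂ : Finset (Fin h)) (hU : Disjoint U₁ U₂) (hW : Disjoint W₁ W₂) :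
    pexpo (U₁ ∪ U₂) (W₁ ∪ W₂) = pexpo U₁ W₁ + pexpo U₂ W₂ := by
  rw [pexpo_def, pexpo_def, pexpo_def]; exact BlockProduct.partitionExpo_union U₁ U₂ W₁ W₂ hU hW

/-! ## 2. Entries of the glued layout on block columns -/

section Glue

variable (s h : ℕ) (B D : Finset (Fin h)) (θ₁ θ₂ : Finset (Fin h) × Finset (Fin h) → ℂ)
  (φ₁ ψ₁ φ₂ ψ₂ : Finset (Fin h) × Finset (Fin h) → Fin h → ℂ)

/-- The two killed members have variable-disjoint supports: coefficients of block-split monomials multiply. -/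
theorem coeff_glue_split (U₁ W₁ U₂ W₂ : Finset (Fin h)) (hU₁ : U₁ ⊆ B) (hW₁ : W₁ ⊆ D) (hU₂ : U₂ ⊆ Bᶜ)
    (hW₂ : W₂ ⊆ Dᶜ) :
    coeff (pexpo (U₁ ∪ U₂) (W₁ ∪ W₂))
      (kill (bvars B D) (anchoredWitness s h θ₁ φ₁ ψ₁) * kill (bvars Bᶜ Dᶜ) (anchoredWitness s h θ₂ φ₂ ψ₂)) =
      coeff (pexpo U₁ W₁) (kill (bvars B D) (anchoredWitness s h θ₁ φ₁ ψ₁)) *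
        coeff (pexpo U₂ W₂) (kill (bvars Bᶜ Dᶜ) (anchoredWitness s h θ₂ φ₂ ψ₂)) := by
  have hU : Disjoint U₁ U₂ := Finset.disjoint_of_subset_left hU₁ (Finset.disjoint_of_subset_right hU₂ disjoint_compl_right)
  have hW : Disjoint W₁ W₂ := Finset.disjoint_of_subset_left hW₁ (Finset.disjoint_of_subset_right hW₂ disjoint_compl_right)
  rw [pexpo_union_blocks U₁ U₂ W₁ W₂ hU hW]
  refine BlockProduct.coeff_mul_of_disjoint_vars (bvars B D) _ _ (support_kill _ _)
    (fun d hd => Finset.disjoint_of_subset_left (support_kill _ _ d hd) (BlockProduct.disjoint_blockVars B D)) _ _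
    ((support_pexpo_subset_bvars U₁ W₁).trans ?_) ?_
  · rw [bvars, bvars]
    exact Finset.union_subset_union (Finset.map_subset_map.mpr hU₁) (Finset.map_subset_map.mpr hW₁)
  · refine Finset.disjoint_of_subset_left ((support_pexpo_subset_bvars U₂ W₂).trans ?_) (BlockProduct.disjoint_blockVars B D)
    rw [bvars]
    exact Finset.union_subset_union (Finset.map_subset_map.mpr hU₂) (Finset.map_subset_map.mpr hW₂)

/-- **Block-1 rows read the block-1 factor** on block-1 columns. -/
theorem coeff_glue_block₁ (U W : Finset (Fin h)) (hU : U ⊆ B) (hW : W ⊆ D) :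
    coeff (pexpo U W)
      (kill (bvars B D) (anchoredWitness s h θ₁ φ₁ ψ₁) * kill (bvars Bᶜ Dᶜ) (anchoredWitness s h θ₂ φ₂ ψ₂)) =
      coeff (pexpo U W) (kill (bvars B D) (anchoredWitness s h θ₁ φ₁ ψ₁)) := by
  have := coeff_glue_split s h B D θ₁ θ₂ φ₁ ψ₁ φ₂ ψ₂ U W ∅ ∅ hU hW (Finset.empty_subset _) (Finset.empty_subset _)
  rw [Finset.union_empty, Finset.union_empty] at this
  rw [this, show pexpo (∅ : Finset (Fin h)) ∅ = 0 from by rw [pexpo_def, Finset.sum_empty, Finset.sum_empty, add_zero],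
    coeff_zero_kill_anchoredWitness, mul_one]

/-- **Block-2 rows read the block-2 factor** on block-2 columns. -/
theorem coeff_glue_block₂ (U W : Finset (Fin h)) (hU : U ⊆ Bᶜ) (hW : W ⊆ Dᶜ) :
    coeff (pexpo U W)
      (kill (bvars B D) (anchoredWitness s h θ₁ φ₁ ψ₁) * kill (bvars Bᶜ Dᶜ) (anchoredWitness s h θ₂ φ₂ ψ₂)) =
      coeff (pexpo U W) (kill (bvars Bᶜ Dᶜ) (anchoredWitness s h θ₂ φ₂ ψ₂)) := by
  have := coeff_glue_split s h B D θ₁ θ₂ φ₁ ψ₁ φ₂ ψ₂ ∅ ∅ U W (Finset.empty_subset _) (Finset.empty_subset _) hU hW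
  rw [Finset.empty_union, Finset.empty_union] at this
  rw [this, show pexpo (∅ : Finset (Fin h)) ∅ = 0 from by rw [pexpo_def, Finset.sum_empty, Finset.sum_empty, add_zero],
    coeff_zero_kill_anchoredWitness, one_mul]

/-- **Nonempty block-2 rows vanish on block-1 columns.** -/
theorem coeff_glue_cross₁ (U W : Finset (Fin h)) (hU : U ⊆ Bᶜ) (hUne : U.Nonempty) (hW : W ⊆ D) :
    coeff (pexpo U W)
      (kill (bvars B D) (anchoredWitness s h θ₁ φ₁ ψ₁) * kill (bvars Bᶜ Dᶜ) (anchoredWitness s h θ₂ φ₂ ψ₂)) = 0 := by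
  have := coeff_glue_split s h B D θ₁ θ₂ φ₁ ψ₁ φ₂ ψ₂ ∅ W U ∅ (Finset.empty_subset _) hW hU (Finset.empty_subset _)
  rw [Finset.empty_union, Finset.union_empty] at this
  rw [this, coeff_yfree_eq_zero s h _ θ₂ φ₂ ψ₂ hUne, mul_zero]

/-- **Nonempty block-1 rows vanish on block-2 columns.** -/
theorem coeff_glue_cross₂ (U W : Finset (Fin h)) (hU : U ⊆ B) (hUne : U.Nonempty) (hW : W ⊆ Dᶜ) :
    coeff (pexpo U W)
      (kill (bvars B D) (anchoredWitness s h θ₁ φ₁ ψ₁) * kill (bvars Bᶜ Dᶜ) (anchoredWitness s h θ₂ φ₂ ψ₂)) = 0 := by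
  have := coeff_glue_split s h B D θ₁ θ₂ φ₁ ψ₁ φ₂ ψ₂ U ∅ ∅ W hU (Finset.empty_subset _) (Finset.empty_subset _) hW
  rw [Finset.union_empty, Finset.empty_union] at this
  rw [this, coeff_yfree_eq_zero s h _ θ₁ φ₁ ψ₁ hUne, zero_mul]

end Glue

/-! ## 3. The wedge theorem -/

/-- **Symbolic non-vanishing of 𝔄_s is closed under wedges.** -/
theorem symbolicDet_wedge_ne_zero (s h : ℕ) (B D : Finset (Fin h)) {r r₁ r₂ : ℕ}
    (u w : Fin r → Finset (Fin h)) (u₁ w₁ : Fin r₁ → Finset (Fin h)) (u₂ w₂ : Fin r₂ → Finset (Fin h))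
    (hu₁B : ∀ i, u₁ i ⊆ B) (hw₁D : ∀ j, w₁ j ⊆ D) (hu₂B : ∀ i, u₂ i ⊆ Bᶜ) (hw₂D : ∀ j, w₂ j ⊆ Dᶜ)
    (hu : Function.Injective u) (hu₁ : Function.Injective u₁) (hu₂ : Function.Injective u₂)
    (h0₁ : ∅ ∈ Set.range u₁) (h0₂ : ∅ ∈ Set.range u₂)
    (hrows : ∀ i, u i ∈ Set.range u₁ ∨ u i ∈ Set.range u₂)
    (hcols₁ : ∀ j₁, w₁ j₁ ∈ Set.range w) (hcols₂ : ∀ j₂, w₂ j₂ ∈ Set.range w)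
    (h₁ : symbolicDet s h r₁ u₁ w₁ ≠ 0) (h₂ : symbolicDet s h r₂ u₂ w₂ ≠ 0) :
    symbolicDet s h r u w ≠ 0 := by
  classical
  obtain ⟨θ₁, φ₁, ψ₁, hd₁⟩ := stub_genericPoint s h r₁ u₁ w₁ h₁
  obtain ⟨θ₂, φ₂, ψ₂, hd₂⟩ := stub_genericPoint s h r₂ u₂ w₂ h₂
  let p : Param h → ℂ
    | Sum.inl α => glueθ B D θ₁ θ₂ α
    | Sum.inr (Sum.inl (α, b)) => glueφ B D φ₁ φ₂ α b
    | Sum.inr (Sum.inr (α, d)) => glueψ B D ψ₁ ψ₂ α d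
  refine symbolicDet_ne_zero_of_hit s h r u w p ?_
  have hp : anchoredWitness s h (fun α => p (Sum.inl α)) (fun α b => p (Sum.inr (Sum.inl (α, b))))
      (fun α d => p (Sum.inr (Sum.inr (α, d)))) =
      kill (bvars B D) (anchoredWitness s h θ₁ φ₁ ψ₁) * kill (bvars Bᶜ Dᶜ) (anchoredWitness s h θ₂ φ₂ ψ₂) :=
    anchoredWitness_glue s h B D θ₁ θ₂ φ₁ ψ₁ φ₂ ψ₂
  rw [hp]
  set F := kill (bvars B D) (anchoredWitness s h θ₁ φ₁ ψ₁) * kill (bvars Bᶜ Dᶜ) (anchoredWitness s h θ₂ φ₂ ψ₂) with hF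
  set F₁ := kill (bvars B D) (anchoredWitness s h θ₁ φ₁ ψ₁) with hF₁
  set F₂ := kill (bvars Bᶜ Dᶜ) (anchoredWitness s h θ₂ φ₂ ψ₂) with hF₂
  -- the factor layouts (of the killed members) are nonsingular
  have hM₁ : (Matrix.of fun i j : Fin r₁ => coeff (pexpo (u₁ i) (w₁ j)) F₁).det ≠ 0 := by
    have hM : (Matrix.of fun i j : Fin r₁ => coeff (pexpo (u₁ i) (w₁ j)) F₁) = Matrix.of fun i j : Fin r₁ =>
        coeff (∑ a ∈ u₁ i, Finsupp.single (Fin.castAdd h a) 1 + ∑ c ∈ w₁ j, Finsupp.single (Fin.natAdd h c) 1)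
          (anchoredWitness s h θ₁ φ₁ ψ₁) := by
      ext i j
      rw [Matrix.of_apply, Matrix.of_apply, hF₁, coeff_kill, if_pos ((support_pexpo_subset_bvars _ _).trans ?_), pexpo_def]
      rw [bvars, bvars]
      exact Finset.union_subset_union (Finset.map_subset_map.mpr (hu₁B i)) (Finset.map_subset_map.mpr (hw₁D j))
    rw [hM]; exact hd₁
  have hM₂ : (Matrix.of fun i j : Fin r₂ => coeff (pexpo (u₂ i) (w₂ j)) F₂).det ≠ 0 := by
    have hM : (Matrix.of fun i j : Fin r₂ => coeff (pexpo (u₂ i) (w₂ j)) F₂) = Matrix.of fun i j : Fin r₂ =>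
        coeff (∑ a ∈ u₂ i, Finsupp.single (Fin.castAdd h a) 1 + ∑ c ∈ w₂ j, Finsupp.single (Fin.natAdd h c) 1)
          (anchoredWitness s h θ₂ φ₂ ψ₂) := by
      ext i j
      rw [Matrix.of_apply, Matrix.of_apply, hF₂, coeff_kill, if_pos ((support_pexpo_subset_bvars _ _).trans ?_), pexpo_def]
      rw [bvars]
      exact Finset.union_subset_union (Finset.map_subset_map.mpr (hu₂B i)) (Finset.map_subset_map.mpr (hw₂D j))
    rw [hM]; exact hd₂
  -- left kernel argument
  intro hdet
  obtain ⟨α, hα, hαM⟩ := Matrix.exists_vecMul_eq_zero_iff.mpr hdet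
  apply hα
  have hcol : ∀ j, ∑ i, α i * coeff (pexpo (u i) (w j)) F = 0 := fun j => by
    have := congrFun hαM j
    simpa [Matrix.vecMul, dotProduct, pexpo_def] using this
  -- evaluation of α along u
  let ev : Finset (Fin h) → ℂ := fun S => ∑ i, α i * (if u i = S then 1 else 0)
  have hev_eq : ∀ i, ev (u i) = α i := by
    intro i
    simp only [ev]
    rw [Finset.sum_eq_single i]
    · rw [if_pos rfl, mul_one]
    · intro i' _ hi'; rw [if_neg (fun h' => hi' (hu h')), mul_zero]
    · intro h'; exact absurd (Finset.mem_univ i) h'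
  -- block 1: β := ev ∘ u₁ is in the left kernel of the factor layout
  have hβ₁ : (fun i₁ => ev (u₁ i₁)) = 0 := by
    by_contra hne
    apply hM₁
    refine Matrix.exists_vecMul_eq_zero_iff.mp ⟨_, hne, ?_⟩
    funext j₁
    obtain ⟨j, hj⟩ := hcols₁ j₁
    have h0 := hcol j
    rw [Matrix.vecMul, dotProduct]  -- goal: ∑ i₁, ev (u₁ i₁) * M₁ i₁ j₁ = 0
    simp only [Matrix.of_apply, Pi.zero_apply]
    -- rewrite each term of the column equation
    have hterm : ∀ i, α i * coeff (pexpo (u i) (w j)) F =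
        ∑ i₁, α i * (if u i = u₁ i₁ then 1 else 0) * coeff (pexpo (u₁ i₁) (w₁ j₁)) F₁ := by
      intro i
      rcases hrows i with ⟨i₁, hi₁⟩ | ⟨i₂, hi₂⟩
      · rw [Finset.sum_eq_single i₁]
        · rw [if_pos hi₁.symm, mul_one, ← hi₁, hj, hF, coeff_glue_block₁ s h B D θ₁ θ₂ φ₁ ψ₁ φ₂ ψ₂ _ _ (hu₁B i₁) (hw₁D j₁)]
        · intro i₁' _ hne'; rw [if_neg (fun h' => hne' (hu₁ (h'.symm.trans hi₁.symm))), mul_zero, zero_mul]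
        · intro h'; exact absurd (Finset.mem_univ _) h'
      · by_cases hmem : ∃ i₁, u i = u₁ i₁
        · obtain ⟨i₁, hi₁⟩ := hmem
          rw [Finset.sum_eq_single i₁]
          · rw [if_pos hi₁, mul_one, hi₁, hj, hF, coeff_glue_block₁ s h B D θ₁ θ₂ φ₁ ψ₁ φ₂ ψ₂ _ _ (hu₁B i₁) (hw₁D j₁)]
          · intro i₁' _ hne'; rw [if_neg (fun h' => hne' (hu₁ (h'.symm.trans hi₁))), mul_zero, zero_mul]
          · intro h'; exact absurd (Finset.mem_univ _) h'
        · -- a genuine block-2 row: nonempty (∅ is a block-1 row), so the entry vanishes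
          have hne : (u i).Nonempty := by
            rw [Finset.nonempty_iff_ne_empty]
            intro h0
            obtain ⟨i₁, hi₁⟩ := h0₁
            exact hmem ⟨i₁, by rw [h0, hi₁]⟩
          rw [← hi₂, hj, hF, coeff_glue_cross₁ s h B D θ₁ θ₂ φ₁ ψ₁ φ₂ ψ₂ _ _ (hu₂B i₂) (hi₂ ▸ hne) (hw₁D j₁), mul_zero]
          symm
          refine Finset.sum_eq_zero (fun i₁ _ => ?_)
          rw [if_neg (fun h' => hmem ⟨i₁, hi₂ ▸ h'⟩), mul_zero, zero_mul]
    rw [Finset.sum_congr rfl (fun i _ => hterm i), Finset.sum_comm] at h0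
    rw [← h0]
    refine Finset.sum_congr rfl (fun i₁ _ => ?_)
    simp only [ev, Finset.sum_mul]
  have hβ₂ : (fun i₂ => ev (u₂ i₂)) = 0 := by
    by_contra hne
    apply hM₂
    refine Matrix.exists_vecMul_eq_zero_iff.mp ⟨_, hne, ?_⟩
    funext j₂
    obtain ⟨j, hj⟩ := hcols₂ j₂
    have h0 := hcol j
    rw [Matrix.vecMul, dotProduct]
    simp only [Matrix.of_apply, Pi.zero_apply]
    have hterm : ∀ i, α i * coeff (pexpo (u i) (w j)) F =
        ∑ i₂, α i * (if u i = u₂ i₂ then 1 else 0) * coeff (pexpo (u₂ i₂) (w₂ j₂)) F₂ := by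
      intro i
      rcases hrows i with ⟨i₁, hi₁⟩ | ⟨i₂, hi₂⟩
      · by_cases hmem : ∃ i₂, u i = u₂ i₂
        · obtain ⟨i₂, hi₂⟩ := hmem
          rw [Finset.sum_eq_single i₂]
          · rw [if_pos hi₂, mul_one, hi₂, hj, hF, coeff_glue_block₂ s h B D θ₁ θ₂ φ₁ ψ₁ φ₂ ψ₂ _ _ (hu₂B i₂) (hw₂D j₂)]
          · intro i₂' _ hne'; rw [if_neg (fun h' => hne' (hu₂ (h'.symm.trans hi₂))), mul_zero, zero_mul]
          · intro h'; exact absurd (Finset.mem_univ _) h'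
        · have hne : (u i).Nonempty := by
            rw [Finset.nonempty_iff_ne_empty]
            intro h0
            obtain ⟨i₂, hi₂⟩ := h0₂
            exact hmem ⟨i₂, by rw [h0, hi₂]⟩
          rw [← hi₁, hj, hF, coeff_glue_cross₂ s h B D θ₁ θ₂ φ₁ ψ₁ φ₂ ψ₂ _ _ (hu₁B i₁) (hi₁ ▸ hne) (hw₂D j₂), mul_zero]
          symm
          refine Finset.sum_eq_zero (fun i₂ _ => ?_)
          rw [if_neg (fun h' => hmem ⟨i₂, hi₁ ▸ h'⟩), mul_zero, zero_mul]
      · rw [Finset.sum_eq_single i₂]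
        · rw [if_pos hi₂.symm, mul_one, ← hi₂, hj, hF, coeff_glue_block₂ s h B D θ₁ θ₂ φ₁ ψ₁ φ₂ ψ₂ _ _ (hu₂B i₂) (hw₂D j₂)]
        · intro i₂' _ hne'; rw [if_neg (fun h' => hne' (hu₂ (h'.symm.trans hi₂.symm))), mul_zero, zero_mul]
        · intro h'; exact absurd (Finset.mem_univ _) h'
    rw [Finset.sum_congr rfl (fun i _ => hterm i), Finset.sum_comm] at h0
    rw [← h0]
    refine Finset.sum_congr rfl (fun i₂ _ => ?_)
    simp only [ev, Finset.sum_mul]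
  -- conclusion
  funext i
  rw [Pi.zero_apply, ← hev_eq i]
  rcases hrows i with ⟨i₁, hi₁⟩ | ⟨i₂, hi₂⟩
  · have := congrFun hβ₁ i₁; rw [Pi.zero_apply] at this; rw [← hi₁]; exact this
  · have := congrFun hβ₂ i₂; rw [Pi.zero_apply] at this; rw [← hi₂]; exact this

end BlockGlue

end

end Summit.ValiantsHypothesis.ValiantsHypothesis.Theorems.BarrierLever.AnchoredPeeling
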